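import Summits.CriticalPhenomena.PercolationContinuityZ3.Theorems.PercNearOneGluingNoHeavyPcintDefectWordCount
import Summits.CriticalPhenomena.PercolationContinuityZ3.Theorems.PercNearOneGluingNoHeavyPcintSubleadingChordLaw
import Summits.CriticalPhenomena.PercolationContinuityZ3.Theorems.PercNearOneGluingNoHeavyPcintPolygonChordLaw
import HarnessLib

/-!
# CriticalPhenomena/PercolationContinuityZ3 — Theorems/PercNearOneGluingNoHeavyPcintPolygonSubleadingLaw.lean: the SUB-LEADING polygon coefficient IS the one-defect structure count — `[σ^{m−1}] 2·2m·p_2m(ℤ^d) = #defectSet(Fin 2m) − m(m−1)·a(m)` for every `m` (mechanism theorem of STRUCTURE law C5-L4)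

Lane prim-pcint, STRUCTURE rule «numerics ⇒ structure ⇒ conjecture» (prim-pcint-2 GEN 21); the assembly of …PcintDefectDiagrams /
DefectWordDiagram / DefectWordCensus / DefectWordStructure / DefectWordUnique / DefectWordCount, the one-defect analogue of …PcintPolygonChordLaw.
* Summing the fibres: **`fullClosingCount_eq_defect`**: `fullClosingCount (k+1) (2(k+2)) = (k+1)!·2^(k+1)·#defectSet (Fin (2(k+2)))` — the
  `2m`-gons of `ℤ^{m−1}` spanning all `m − 1` axes are the labelled oriented one-defect structures with both switched diagrams irreducible (L4a).
* With gen 20's binomial form `closingCount d (2m) = d(d−1)⋯(d−m+1)·2^m·a(m) + Σ_{j<m} C(d,j)·fullClosingCount j (2m)` and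
  `(d^m − d(d−1)⋯(d−m+1))/d^{m−1} → C(m,2)` (`tendsto_pow_sub_descFactorial_div`):
  **`tendsto_closingCount_subleading`**: `(closingCount d (2m) − a(m)(2d)^m)/(2d)^{m−1} → #defectSet(Fin 2m) − m(m−1)·a(m)` for every `m ≥ 2`.
* Hence the typed law `polygonSubleadingCoeffLaw` (…PcintSubleadingChordLaw, prediction P22) is EQUIVALENT to the pure counting identity
  `#defectSet (Fin 2m) = oneDefect m` for all `m ≥ 2` (`polygonSubleadingCoeffLaw_iff`), and the instances proved there from the exact polygon
  polynomials give **`#defectSet (Fin 4) = 0`, `#defectSet (Fin 6) = 3`, `#defectSet (Fin 8) = 62`, `#defectSet (Fin 10) = 1205`** as theorems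
  (`card_defectSet_values`) — the switch graphs on the connected chord diagrams with `2, 3, 4, 5` chords have `0, 3, 62, 1205` edges.

HONEST FRAMING: theorems about polygon counts (STRUCTURE programme, law C5-L4: mechanism proved for all `m`; the closed form for the structure
count remains the typed conjecture beyond `m = 5`).  No `sorry`; standard axioms.  Written by prim-pcint-2 gen 21 (prover-prim-pcint-2-g21-0),
2026-08-27.
-/

noncomputable section

namespace Summit.CriticalPhenomena.PercolationContinuityZ3.Theorems.Pcint.ChordDiag

open scoped Nat
open Literature.Probability.LatticeModels Literature.Probability.Percolation
open Summit.CriticalPhenomena.PercolationContinuityZ3.Theorems.Pcint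
open Summit.CriticalPhenomena.PercolationContinuityZ3.Theorems.Pcint.MemoryTail

variable {K k j : ℕ}

/-! ### Every full closing word lies over exactly one structure -/

/-- **Every full closing word of length `2k+3` on `k+1` axes is compatible with a one-defect structure whose switched diagrams are irreducible.**
[folklore] -/
theorem exists_defect_dcompat (hK : K + 1 = 2 * (k + 2)) {w : Fin K → Fin (k + 1) × Bool} (hw : w ∈ fullWords K k) :
    ∃ t ∈ defectSet (Fin (K + 1)), DCompat t.1 t.2.1 t.2.2 w := by
  rw [mem_fullWords] at hw
  obtain ⟨hsaw, hl1, hax⟩ := hw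
  have huse : ∀ c, 1 ≤ uses w c := fun c => by
    obtain ⟨t, ht⟩ := hax c
    exact Finset.card_pos.2 ⟨t, Finset.mem_filter.2 ⟨Finset.mem_univ _, ht⟩⟩
  obtain ⟨π, a, b, v, hd, h, hW⟩ := exists_fcompat huse hl1 (by omega)
  obtain ⟨hgP, hgX⟩ := (isSAW_iff_isGood_switch hd h hW).1 hsaw
  exact ⟨(π, a, b), mem_defectSet.2 ⟨hd, h, hgP, hgX⟩, v, hW⟩

open Classical in
/-- The structure of a word (junk if none). [folklore] -/
def dstructOf (w : Fin K → Fin j × Bool) : (Fin (K + 1) → Fin (K + 1)) × Fin (K + 1) × Fin (K + 1) :=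
  if h : ∃ t, t ∈ defectSet (Fin (K + 1)) ∧ DCompat t.1 t.2.1 t.2.2 w then h.choose else (id, 0, 0)

/-- The structure of a full closing word has irreducible switched diagrams and is compatible with the word. [folklore] -/
theorem dstructOf_spec (hK : K + 1 = 2 * (k + 2)) {w : Fin K → Fin (k + 1) × Bool} (hw : w ∈ fullWords K k) :
    dstructOf w ∈ defectSet (Fin (K + 1)) ∧ DCompat (dstructOf w).1 (dstructOf w).2.1 (dstructOf w).2.2 w := by
  have hex : ∃ t, t ∈ defectSet (Fin (K + 1)) ∧ DCompat t.1 t.2.1 t.2.2 w := by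
    obtain ⟨t, ht, hc⟩ := exists_defect_dcompat hK hw; exact ⟨t, ht, hc⟩
  unfold dstructOf
  rw [dif_pos hex]
  exact hex.choose_spec

/-- Two compatible structures of one word coincide. [folklore] -/
theorem dcompat_unique {t t' : (Fin (K + 1) → Fin (K + 1)) × Fin (K + 1) × Fin (K + 1)} {w : Fin K → Fin j × Bool}
    (ht : t ∈ defectSet (Fin (K + 1))) (ht' : t' ∈ defectSet (Fin (K + 1))) (hc : DCompat t.1 t.2.1 t.2.2 w)
    (hc' : DCompat t'.1 t'.2.1 t'.2.2 w) : t = t' := by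
  obtain ⟨hd, h, -, -⟩ := mem_defectSet.1 ht
  obtain ⟨hd', h', -, -⟩ := mem_defectSet.1 ht'
  obtain ⟨v, hW⟩ := hc
  obtain ⟨v', hW'⟩ := hc'
  obtain ⟨h1, h2, h3⟩ := fcompat_unique hd h hW hd' h' hW'
  exact Prod.ext h1 (Prod.ext h2 h3)

/-- **The count**: `#fullWords = #defectSet · (k+1)! · 2^(k+1)`. [folklore] -/
theorem card_fullWords_defect (hK : K + 1 = 2 * (k + 2)) :
    (fullWords K k).card = (defectSet (Fin (K + 1))).card * ((k + 1)! * 2 ^ (k + 1)) := by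
  classical
  rw [Finset.card_eq_sum_card_fiberwise (f := dstructOf) (t := defectSet (Fin (K + 1)))
    (fun w hw => (dstructOf_spec hK hw).1)]
  rw [← Finset.sum_const_nat (m := (k + 1)! * 2 ^ (k + 1)) (f := fun t => (dfibre k t).card) ?_]
  · refine Finset.sum_congr rfl fun t ht => ?_
    congr 1
    ext w
    unfold dfibre
    rw [Finset.mem_filter, Finset.mem_filter]
    refine and_congr_right fun hw => ⟨fun he => he ▸ (dstructOf_spec hK hw).2, fun hc => ?_⟩
    have hs := dstructOf_spec hK hw
    exact dcompat_unique hs.1 ht hs.2 hc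
  · rintro ⟨π, a, b⟩ ht
    obtain ⟨hd, h, hgP, hgX⟩ := mem_defectSet.1 ht
    exact card_dfibre hK hd h hgP hgX

/-- **`fullClosingCount (k+1) (2(k+2)) = (k+1)!·2^(k+1)·#defectSet (Fin (2(k+2)))`**: the `2m`-gons of `ℤ^{m−1}` spanning all `m − 1` axes are
`(m−1)!·2^{m−1}` times the one-defect structures with both switched diagrams irreducible (L4a of STRUCTURE law C5-L4, all `m`). [folklore] -/
theorem fullClosingCount_eq_defect (k : ℕ) :
    fullClosingCount (k + 1) (2 * (k + 2)) = (k + 1)! * 2 ^ (k + 1) * (defectSet (Fin (2 * (k + 2)))).card := by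
  rw [show 2 * (k + 2) = (2 * k + 3) + 1 by ring, fullClosingCount_eq_card, card_fullWords_defect (by ring)]
  ring

end Summit.CriticalPhenomena.PercolationContinuityZ3.Theorems.Pcint.ChordDiag

/-! ### The sub-leading polygon coefficient -/

namespace Summit.CriticalPhenomena.PercolationContinuityZ3.Theorems.Pcint.MemoryTail

open Filter Topology
open scoped Nat
open Literature.Probability.LatticeModels Literature.Probability.Percolation
open Summit.CriticalPhenomena.PercolationContinuityZ3.Theorems.Pcint
open Summit.CriticalPhenomena.PercolationContinuityZ3.Theorems.Pcint.ChordDiag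

/-- **`(d^{m+1} − d(d−1)⋯(d−m))/d^m → C(m+1, 2)`**: the second coefficient of the falling factorial. [folklore] -/
theorem tendsto_pow_sub_descFactorial_div (m : ℕ) :
    Tendsto (fun d : ℕ => ((d : ℝ) ^ (m + 1) - (d.descFactorial (m + 1) : ℝ)) / (d : ℝ) ^ m) atTop (𝓝 (((m + 1).choose 2 : ℕ) : ℝ)) := by
  induction m with
  | zero =>
    simp only [zero_add, pow_one, Nat.descFactorial_one, pow_zero, div_one, sub_self, Nat.choose_succ_self, Nat.cast_zero]
    exact tendsto_const_nhds
  | succ m ih =>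
    have h2 := (Literature.Analysis.Complex.PolyaSchur.tendsto_descFactorial_div_pow (m + 1)).const_mul ((m + 1 : ℕ) : ℝ)
    have hsum := ih.add h2
    rw [mul_one, ← Nat.cast_add, show (m + 1).choose 2 + (m + 1) = (m + 1 + 1).choose 2 by
      rw [Nat.choose_succ_succ (m + 1) 1, Nat.choose_one_right]; ring] at hsum
    refine hsum.congr' ?_
    filter_upwards [Filter.eventually_ge_atTop (m + 1)] with d hd
    have hd0 : (d : ℝ) ≠ 0 := by exact_mod_cast (show d ≠ 0 by omega)
    have hdf : (d.descFactorial (m + 1 + 1) : ℝ) = ((d : ℝ) - (m + 1 : ℕ)) * (d.descFactorial (m + 1) : ℝ) := by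
      rw [Nat.descFactorial_succ, Nat.cast_mul, Nat.cast_sub hd]
    rw [hdf, pow_succ, pow_succ]
    field_simp
    ring

/-- **The sub-leading polygon coefficient is the one-defect structure count minus `m(m−1)a(m)`** (`m = k + 2`):
`(closingCount d (2m) − a(m)·(2d)^m)/(2d)^{m−1} → #defectSet (Fin 2m) − m(m−1)·a(m)` as `d → ∞`. [folklore] -/
theorem tendsto_closingCount_subleading (k : ℕ) :
    Tendsto (fun d : ℕ => ((closingCount d (2 * (k + 2)) : ℝ) - (connChord (k + 2) : ℝ) * (2 * (d : ℝ)) ^ (k + 2)) / (2 * (d : ℝ)) ^ (k + 1))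
      atTop (𝓝 (((defectSet (Fin (2 * (k + 2)))).card : ℝ) - ((k : ℝ) + 2) * ((k : ℝ) + 1) * (connChord (k + 2) : ℝ))) := by
  set D : ℕ := (defectSet (Fin (2 * (k + 2)))).card with hD
  set A : ℕ := connChord (k + 2) with hA
  -- the expansion of the count, for `d ≥ 1`
  have key : ∀ d : ℕ, 1 ≤ d →
      ((closingCount d (2 * (k + 2)) : ℝ) - (A : ℝ) * (2 * (d : ℝ)) ^ (k + 2)) / (2 * (d : ℝ)) ^ (k + 1) =
        (A : ℝ) * (-2) * ((((d : ℝ) ^ (k + 2) - (d.descFactorial (k + 2) : ℝ))) / (d : ℝ) ^ (k + 1)) +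
          (D : ℝ) * ((d.descFactorial (k + 1) : ℝ) / (d : ℝ) ^ (k + 1)) +
            ∑ j ∈ Finset.range (k + 1), (fullClosingCount j (2 * (k + 2)) : ℝ) * ((d.choose j : ℝ) / ((2 : ℝ) * d) ^ (k + 1)) := by
    intro d hd
    have hd0 : (d : ℝ) ≠ 0 := by exact_mod_cast (show d ≠ 0 by omega)
    have hcc := closingCount_two_mul_eq d (k + 1)
    rw [show k + 1 + 1 = k + 2 from rfl, Finset.sum_range_succ, fullClosingCount_eq_defect k] at hcc
    have hterm : (d.choose (k + 1) : ℝ) * (((k + 1)! * 2 ^ (k + 1) * D : ℕ) : ℝ) =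
        (d.descFactorial (k + 1) : ℝ) * 2 ^ (k + 1) * (D : ℝ) := by
      rw [Nat.descFactorial_eq_factorial_mul_choose]; push_cast; ring
    rw [hcc]
    push_cast
    rw [show ((d.choose (k + 1) : ℝ)) * (((k + 1)! : ℝ) * 2 ^ (k + 1) * (D : ℝ)) =
        (d.descFactorial (k + 1) : ℝ) * 2 ^ (k + 1) * (D : ℝ) by exact_mod_cast hterm]
    have hS : ∑ j ∈ Finset.range (k + 1), (fullClosingCount j (2 * (k + 2)) : ℝ) * ((d.choose j : ℝ) / ((2 : ℝ) * d) ^ (k + 1)) =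
        (∑ j ∈ Finset.range (k + 1), (d.choose j : ℝ) * (fullClosingCount j (2 * (k + 2)) : ℝ)) / ((2 : ℝ) * d) ^ (k + 1) := by
      rw [Finset.sum_div]
      exact Finset.sum_congr rfl fun j _ => by ring
    rw [hS]
    set S := ∑ j ∈ Finset.range (k + 1), (d.choose j : ℝ) * (fullClosingCount j (2 * (k + 2)) : ℝ) with hSdef
    rw [mul_pow, pow_succ (d : ℝ) (k + 1), pow_succ (2 : ℝ) (k + 1)]
    field_simp
    ring
  have h1 := (tendsto_pow_sub_descFactorial_div (k + 1)).const_mul ((A : ℝ) * (-2))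
  have h2 := (Literature.Analysis.Complex.PolyaSchur.tendsto_descFactorial_div_pow (k + 1)).const_mul (D : ℝ)
  have h3 : Tendsto (fun d : ℕ => ∑ j ∈ Finset.range (k + 1),
      (fullClosingCount j (2 * (k + 2)) : ℝ) * ((d.choose j : ℝ) / ((2 : ℝ) * d) ^ (k + 1))) atTop (𝓝 0) := by
    rw [show (0 : ℝ) = ∑ j ∈ Finset.range (k + 1), (fullClosingCount j (2 * (k + 2)) : ℝ) * 0 by simp]
    exact tendsto_finsetSum _ fun j hj => (tendsto_choose_div_pow (by have := Finset.mem_range.1 hj; omega)).const_mul _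
  have hlim := (h1.add h2).add h3
  rw [show k + 1 + 1 = k + 2 from rfl, mul_one, add_zero] at hlim
  have h2c : (((k + 2).choose 2 : ℕ) : ℝ) * 2 = ((k : ℝ) + 2) * ((k : ℝ) + 1) := by
    have h := Nat.choose_two_right (k + 2)
    rw [show k + 2 - 1 = k + 1 from rfl] at h
    have hdvd : 2 ∣ (k + 2) * (k + 1) := by
      have := Nat.even_mul_succ_self (k + 1)
      rw [mul_comm] at this
      exact even_iff_two_dvd.1 this
    have h' : (k + 2).choose 2 * 2 = (k + 2) * (k + 1) := by rw [h]; exact Nat.div_mul_cancel hdvd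
    have h'' : (((k + 2).choose 2 : ℕ) : ℝ) * 2 = ((k + 2 : ℕ) : ℝ) * ((k + 1 : ℕ) : ℝ) := by exact_mod_cast h'
    rw [h'']; push_cast; ring
  have hval : (A : ℝ) * (-2) * (((k + 2).choose 2 : ℕ) : ℝ) + (D : ℝ) = (D : ℝ) - ((k : ℝ) + 2) * ((k : ℝ) + 1) * (A : ℝ) := by
    linear_combination (-(A : ℝ)) * h2c
  rw [← hval]
  refine hlim.congr' ?_
  filter_upwards [Filter.eventually_ge_atTop 1] with d hd
  exact (key d hd).symm

/-- **The law at one rung is the counting identity at that rung**: `#defectSet (Fin 2m) = oneDefect m` iff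
`(closingCount d (2m) − a(m)(2d)^m)/(2d)^{m−1} → subleadingCoeff m` (`m = k + 2`). [folklore] -/
theorem card_defectSet_eq_oneDefect_iff (k : ℕ) :
    ((defectSet (Fin (2 * (k + 2)))).card : ℤ) = oneDefect (k + 2) ↔
      Tendsto (fun d : ℕ => ((closingCount d (2 * (k + 2)) : ℝ) - (connChord (k + 2) : ℝ) * (2 * (d : ℝ)) ^ (k + 2)) /
        (2 * (d : ℝ)) ^ (k + 2 - 1)) atTop (𝓝 ((subleadingCoeff (k + 2) : ℤ) : ℝ)) := by
  have ht := tendsto_closingCount_subleading k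
  rw [show k + 2 - 1 = k + 1 from rfl]
  have hsub : ((subleadingCoeff (k + 2) : ℤ) : ℝ) = (oneDefect (k + 2) : ℝ) - ((k : ℝ) + 2) * ((k : ℝ) + 1) * (connChord (k + 2) : ℝ) := by
    unfold subleadingCoeff; push_cast; ring
  constructor
  · intro h
    rw [hsub, ← h]; push_cast; exact ht
  · intro h
    have := tendsto_nhds_unique ht h
    rw [hsub] at this
    have h' : ((defectSet (Fin (2 * (k + 2)))).card : ℝ) = (oneDefect (k + 2) : ℝ) := by linarith
    exact_mod_cast h'

/-- **STRUCTURE law C5-L4 is equivalent to the counting identity** `#defectSet (Fin 2m) = oneDefect m` for all `m ≥ 2`. [folklore] -/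
theorem polygonSubleadingCoeffLaw_iff :
    polygonSubleadingCoeffLaw ↔ ∀ k : ℕ, ((defectSet (Fin (2 * (k + 2)))).card : ℤ) = oneDefect (k + 2) := by
  constructor
  · intro h k
    exact (card_defectSet_eq_oneDefect_iff k).2 (h (k + 2) (by omega))
  · intro h m hm
    obtain ⟨k, rfl⟩ : ∃ k, m = k + 2 := ⟨m - 2, by omega⟩
    exact (card_defectSet_eq_oneDefect_iff k).1 (h k)

/-- **The first structure counts as theorems**: the one-defect structures with both switched diagrams irreducible on `4, 6, 8, 10` points
number `0, 3, 62, 1205` (= the edges of the switch graph on the connected chord diagrams with `2, 3, 4, 5` chords), read off the exact polygon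
polynomials of the tree. [folklore] -/
theorem card_defectSet_values :
    (defectSet (Fin 4)).card = 0 ∧ (defectSet (Fin 6)).card = 3 ∧ (defectSet (Fin 8)).card = 62 ∧ (defectSet (Fin 10)).card = 1205 := by
  have h2 := (card_defectSet_eq_oneDefect_iff 0).2 polygonSubleadingCoeff_two
  have h3 := (card_defectSet_eq_oneDefect_iff 1).2 polygonSubleadingCoeff_three
  have h4 := (card_defectSet_eq_oneDefect_iff 2).2 polygonSubleadingCoeff_four
  have h5 := (card_defectSet_eq_oneDefect_iff 3).2 polygonSubleadingCoeff_five
  rw [oneDefect_values.1] at h2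
  rw [oneDefect_values.2.1] at h3
  rw [oneDefect_values.2.2.1] at h4
  rw [oneDefect_values.2.2.2.1] at h5
  change ((defectSet (Fin 4)).card : ℤ) = 0 at h2
  change ((defectSet (Fin 6)).card : ℤ) = 3 at h3
  change ((defectSet (Fin 8)).card : ℤ) = 62 at h4
  change ((defectSet (Fin 10)).card : ℤ) = 1205 at h5
  refine ⟨?_, ?_, ?_, ?_⟩
  · exact_mod_cast h2
  · exact_mod_cast h3
  · exact_mod_cast h4
  · exact_mod_cast h5

end Summit.CriticalPhenomena.PercolationContinuityZ3.Theorems.Pcint.MemoryTail
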